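import Literature.MathematicalPhysics.KineticTheory.SiteChainFokkerPlanckIBP
import Literature.MathematicalPhysics.KineticTheory.SiteChainFokkerPlanckCutoff
import HarnessLib

/-!
# Fokker–Planck identification for site-inhomogeneous chains, III: the truncations `χ(H/R) m_M(ρ)`

Topic `Literature/MathematicalPhysics/KineticTheory`, grouping namespace `…KineticTheory.HeatConduction`.
For a site-dependent chain `P : SiteChain` with `C²` potentials and a `C²` solution `ρ ≥ 0` of the
stationary Fokker–Planck equation `L̂ρ + 2γρ = 0` (`L̂ = sdeGenerator (-Y) v_L v_R`,
`Y = P.langevinDrift N`), the compactly supported `C²` truncations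
`f_{R,M} = χ(H/R) · m_M(ρ)` with the energy cutoff `χ(H/R)` (`SiteChainFokkerPlanckCutoff.lean`) and the
height truncation `m_M(s) = M φ(s/M)` (`SiteChainFokkerPlanckProfiles.lean`):

* `revGenerator_truncation_add_eq` — the stationary defect, pointwise:
  `L̂ f + 2γ f = a [2γ (m(ρ) - ρ m'(ρ)) + ½ m''(ρ) Γ(ρ,ρ)] + m(ρ) L̂ a + m'(ρ) Γ(a, ρ)`, `a = χ(H/R)`;
* `abs_revGenerator_truncation_add_le` — hence
  `|L̂ f + 2γ f| ≤ 2γ θ_M(ρ) + ½ a (-m''(ρ)) Γ(ρ,ρ) + ρ |L̂ a| + m'(ρ) |Γ(a,ρ)|`, `θ_M(s) = s[M < s]`;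
* the first two `L¹` pieces: the height terms `½ ∫ a (-m''(ρ)) Γ(ρ,ρ) ≤ (K + 2γ) ∫ θ_M(ρ)`
  (entropy-type identity with `F = s - m_M(s)`, `half_integral_height_le`) and the cutoff term
  `ρ |L̂ a| ≤ K 1_{R ≤ H} ρ` (`mul_abs_revGenerator_cutoff_le`), plus the AM–GM step on the shell
  `m'(ρ)|y| ≤ ½(εW(ρ + δ) + F''(ρ) y²/ε)` for a Fisher curvature `F''` (`smoothCutoff_div_mul_abs_le`).

Twin of `Summits/…/EmbeddedDrudeMourreNessUniqueTruncation.lean` (and the first lemmas of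
`…Defect.lean`) for site-dependent data.

## References

* N. Cuneo, J.-P. Eckmann, M. Hairer, L. Rey-Bellet, Electron. J. Probab. **23** (2018) no. 55, §3.1.
* D. Bakry, I. Gentil, M. Ledoux, *Analysis and Geometry of Markov Diffusion Operators* (2014), §1.4.2.
-/

noncomputable section

open MeasureTheory Filter Topology Set
open scoped ContDiff NNReal ENNReal

namespace Literature.MathematicalPhysics.KineticTheory.HeatConduction

open Literature.MathematicalPhysics.KineticTheory

variable {N : ℕ} {P : SiteChain} {T_L T_R : ℝ} {ρ : PhaseSpace N → ℝ}

namespace SiteChain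

/-! ### The truncations and their stationary defect, pointwise -/

/-- The truncation has compact support (uniformly confining potentials, `R > 0`). [folklore] -/
theorem UniformlyConfining.hasCompactSupport_truncation (hP : P.UniformlyConfining) (M : ℝ) {R : ℝ} (hR : 0 < R) :
    HasCompactSupport fun y => smoothCutoff (P.hamiltonian N y / R) * (M * linCutoff (ρ y / M)) :=
  (hP.hasCompactSupport_energyCutoff N hR).mul_right

/-- `0 ≤ f ≤ ρ` for `ρ ≥ 0`, `M > 0`. [folklore] -/
theorem truncation_mem_Icc (hρ0 : ∀ x, 0 ≤ ρ x) {M : ℝ} (hM : 0 < M) (R : ℝ) (x : PhaseSpace N) :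
    smoothCutoff (P.hamiltonian N x / R) * (M * linCutoff (ρ x / M)) ∈ Icc 0 (ρ x) := by
  have h := heightCutoff_mem_Icc hM (hρ0 x)
  have ha := P.energyCutoff_mem_Icc R x
  exact ⟨mul_nonneg ha.1 h.1, (mul_le_of_le_one_left h.1 ha.2).trans h.2⟩

variable (hU : ∀ i, ContDiff ℝ 2 (P.U i)) (hV : ∀ i, ContDiff ℝ 2 (P.V i)) (hρ : ContDiff ℝ 2 ρ)
  (hpde : ∀ x, sdeGenerator (fun y => -P.langevinDrift N y) (P.noiseVecL N T_L) (P.noiseVecR N T_R) ρ x +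
    2 * P.γ * ρ x = 0)
include hU hV hρ

/-- The truncation `f = χ(H/R) m_M(ρ)` is `C²`. [folklore] -/
theorem contDiff_truncation (M R : ℝ) :
    ContDiff ℝ 2 fun y => smoothCutoff (P.hamiltonian N y / R) * (M * linCutoff (ρ y / M)) :=
  (P.contDiff_energyCutoff hU hV N R).mul ((contDiff_two_heightCutoff M).comp hρ)

include hpde

/-- **The stationary defect of the truncation**, pointwise (site-dependent chain, `M ≠ 0`):
`L̂ f + 2γ f = a [2γ (m(ρ) - ρ m'(ρ)) + ½ m''(ρ) Γ(ρ,ρ)] + m(ρ) L̂ a + m'(ρ) Γ(a, ρ)`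
with `a = χ(H/R)`, `m = m_M`, `m' = χ(·/M)`, `m'' = χ'(·/M)/M`. [folklore] -/
theorem revGenerator_truncation_add_eq {M : ℝ} (hM : M ≠ 0) (R : ℝ) (x : PhaseSpace N) :
    sdeGenerator (fun y => -P.langevinDrift N y) (P.noiseVecL N T_L) (P.noiseVecR N T_R)
        (fun y => smoothCutoff (P.hamiltonian N y / R) * (M * linCutoff (ρ y / M))) x +
      2 * P.γ * (smoothCutoff (P.hamiltonian N x / R) * (M * linCutoff (ρ x / M))) =
    smoothCutoff (P.hamiltonian N x / R) *
        (2 * P.γ * (M * linCutoff (ρ x / M) - ρ x * smoothCutoff (ρ x / M)) +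
          (1 / 2) * (deriv smoothCutoff (ρ x / M) / M) *
            carreDuChamp (P.noiseVecL N T_L) (P.noiseVecR N T_R) ρ ρ x) +
      M * linCutoff (ρ x / M) *
        sdeGenerator (fun y => -P.langevinDrift N y) (P.noiseVecL N T_L) (P.noiseVecR N T_R)
          (fun y => smoothCutoff (P.hamiltonian N y / R)) x +
      smoothCutoff (ρ x / M) *
        carreDuChamp (P.noiseVecL N T_L) (P.noiseVecR N T_R)
          (fun y => smoothCutoff (P.hamiltonian N y / R)) ρ x := by
  set vL := P.noiseVecL N T_L
  set vR := P.noiseVecR N T_R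
  set a : PhaseSpace N → ℝ := fun y => smoothCutoff (P.hamiltonian N y / R) with ha
  set m : ℝ → ℝ := fun s => M * linCutoff (s / M) with hm
  have ha2 : ContDiff ℝ 2 a := P.contDiff_energyCutoff hU hV N R
  have hm2 : ContDiff ℝ 2 fun y => m (ρ y) := (contDiff_two_heightCutoff M).comp hρ
  have hρd : Differentiable ℝ ρ := hρ.differentiable (by norm_num)
  have hprod := sdeGenerator_mul' (fun y => -P.langevinDrift N y) vL vR ha2 hm2 x
  have hcomp := sdeGenerator_comp_eq (fun y => -P.langevinDrift N y) vL vR (hasDerivAt_scaled_linCutoff hM)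
    (hasDerivAt_scaled_smoothCutoff M) hρ x
  have hΓ : carreDuChamp vL vR a (fun y => m (ρ y)) x = smoothCutoff (ρ x / M) * carreDuChamp vL vR a ρ x := by
    rw [carreDuChamp_comm, carreDuChamp_comp_left vL vR (hasDerivAt_scaled_linCutoff hM) hρd a x,
      carreDuChamp_comm]
  have hLρ : sdeGenerator (fun y => -P.langevinDrift N y) vL vR ρ x = -(2 * P.γ * ρ x) := by
    have := hpde x; linarith
  show sdeGenerator (fun y => -P.langevinDrift N y) vL vR (fun y => a y * m (ρ y)) x + 2 * P.γ * (a x * m (ρ x)) =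
    a x * (2 * P.γ * (m (ρ x) - ρ x * smoothCutoff (ρ x / M)) +
      (1 / 2) * (deriv smoothCutoff (ρ x / M) / M) * carreDuChamp vL vR ρ ρ x) +
    m (ρ x) * sdeGenerator (fun y => -P.langevinDrift N y) vL vR a x +
      smoothCutoff (ρ x / M) * carreDuChamp vL vR a ρ x
  rw [hprod, hcomp, hΓ, hLρ]
  ring

/-- **Pointwise bound on the stationary defect** (site-dependent chain): for `ρ ≥ 0`, `M > 0`,
`|L̂ f + 2γ f| ≤ 2γ θ_M(ρ) + ½ a (-m''(ρ)) Γ(ρ,ρ) + ρ |L̂ a| + m'(ρ) |Γ(a,ρ)|`,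
`θ_M(s) = s [M < s]`. [folklore] -/
theorem abs_revGenerator_truncation_add_le (hγ : 0 ≤ P.γ) (hρ0 : ∀ x, 0 ≤ ρ x) {M : ℝ} (hM : 0 < M)
    (R : ℝ) (x : PhaseSpace N) :
    |sdeGenerator (fun y => -P.langevinDrift N y) (P.noiseVecL N T_L) (P.noiseVecR N T_R)
        (fun y => smoothCutoff (P.hamiltonian N y / R) * (M * linCutoff (ρ y / M))) x +
      2 * P.γ * (smoothCutoff (P.hamiltonian N x / R) * (M * linCutoff (ρ x / M)))| ≤
    2 * P.γ * (if M < ρ x then ρ x else 0) +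
      (1 / 2) * (smoothCutoff (P.hamiltonian N x / R) * (-(deriv smoothCutoff (ρ x / M) / M) *
        carreDuChamp (P.noiseVecL N T_L) (P.noiseVecR N T_R) ρ ρ x)) +
      ρ x * |sdeGenerator (fun y => -P.langevinDrift N y) (P.noiseVecL N T_L) (P.noiseVecR N T_R)
          (fun y => smoothCutoff (P.hamiltonian N y / R)) x| +
      smoothCutoff (ρ x / M) *
        |carreDuChamp (P.noiseVecL N T_L) (P.noiseVecR N T_R)
          (fun y => smoothCutoff (P.hamiltonian N y / R)) ρ x| := by
  rw [revGenerator_truncation_add_eq hU hV hρ hpde hM.ne' R x]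
  set vL := P.noiseVecL N T_L
  set vR := P.noiseVecR N T_R
  set ax := smoothCutoff (P.hamiltonian N x / R)
  set mx := M * linCutoff (ρ x / M)
  set m1 := smoothCutoff (ρ x / M)
  set m2 := deriv smoothCutoff (ρ x / M) / M
  set Γρ := carreDuChamp vL vR ρ ρ x
  set La := sdeGenerator (fun y => -P.langevinDrift N y) vL vR (fun y => smoothCutoff (P.hamiltonian N y / R)) x
  set Γa := carreDuChamp vL vR (fun y => smoothCutoff (P.hamiltonian N y / R)) ρ x
  have hax := P.energyCutoff_mem_Icc R x
  have hmx := heightCutoff_mem_Icc hM (hρ0 x)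
  have hm1 : 0 ≤ m1 := smoothCutoff_nonneg _
  have hm2 : m2 ≤ 0 := deriv_smoothCutoff_div_nonpos hM _
  have hΓρ : 0 ≤ Γρ := carreDuChamp_self_nonneg vL vR ρ x
  obtain ⟨-, -, hG0, hGθ⟩ := sub_heightCutoff_bounds hM (hρ0 x)
  have hG0' : 0 ≤ mx - ρ x * m1 := by simp only [mx, m1] at hG0 ⊢; linarith
  have hGθ' : mx - ρ x * m1 ≤ (if M < ρ x then ρ x else 0) := by simp only [mx, m1] at hGθ ⊢; linarith
  have h2γ : 0 ≤ 2 * P.γ := by linarith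
  have t1 : |ax * (2 * P.γ * (mx - ρ x * m1))| ≤ 2 * P.γ * (if M < ρ x then ρ x else 0) := by
    rw [abs_of_nonneg (mul_nonneg hax.1 (mul_nonneg h2γ hG0'))]
    calc ax * (2 * P.γ * (mx - ρ x * m1)) ≤ 1 * (2 * P.γ * (mx - ρ x * m1)) :=
          mul_le_mul_of_nonneg_right hax.2 (mul_nonneg h2γ hG0')
      _ ≤ 2 * P.γ * (if M < ρ x then ρ x else 0) := by
          rw [one_mul]; exact mul_le_mul_of_nonneg_left hGθ' h2γ
  have t2 : |ax * ((1 / 2) * m2 * Γρ)| = (1 / 2) * (ax * (-m2 * Γρ)) := by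
    rw [abs_of_nonpos]
    · ring
    · have : 0 ≤ ax * (-m2 * Γρ) := mul_nonneg hax.1 (mul_nonneg (by linarith) hΓρ)
      nlinarith
  have t3 : |mx * La| ≤ ρ x * |La| := by
    rw [abs_mul, abs_of_nonneg hmx.1]
    exact mul_le_mul_of_nonneg_right hmx.2 (abs_nonneg _)
  have t4 : |m1 * Γa| = m1 * |Γa| := by rw [abs_mul, abs_of_nonneg hm1]
  calc |ax * (2 * P.γ * (mx - ρ x * m1) + (1 / 2) * m2 * Γρ) + mx * La + m1 * Γa|
      ≤ |ax * (2 * P.γ * (mx - ρ x * m1))| + |ax * ((1 / 2) * m2 * Γρ)| + |mx * La| + |m1 * Γa| := by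
        have e : ax * (2 * P.γ * (mx - ρ x * m1) + (1 / 2) * m2 * Γρ) + mx * La + m1 * Γa =
            ax * (2 * P.γ * (mx - ρ x * m1)) + ax * ((1 / 2) * m2 * Γρ) + mx * La + m1 * Γa := by ring
        rw [e]
        refine (abs_add_le _ _).trans (add_le_add ((abs_add_le _ _).trans (add_le_add ?_ le_rfl)) le_rfl)
        exact abs_add_le _ _
    _ ≤ 2 * P.γ * (if M < ρ x then ρ x else 0) + (1 / 2) * (ax * (-m2 * Γρ)) + ρ x * |La| + m1 * |Γa| := by
        rw [t2, t4]; linarith [t1, t3]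

/-! ### The height terms and the cutoff term in `L¹` -/

/-- **The height terms** (site-dependent chain, `N ≥ 1`, `ρ` integrable, uniformly confining):
`½ ∫ χ(H/R) (-m_M''(ρ)) Γ(ρ,ρ) ≤ (K + 2γ) ∫ θ_M(ρ)` whenever `|L χ(H/R)| ≤ K` (entropy-type identity
with `F(s) = s - m_M(s)`, `0 ≤ F, sF' - F ≤ θ_M`). [folklore] -/
theorem half_integral_height_le (hP : P.UniformlyConfining) (hN : 0 < N) (hρ0 : ∀ x, 0 ≤ ρ x) (hρi : Integrable ρ)
    {M R K : ℝ} (hM : 0 < M) (hR : 0 < R)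
    (hK : ∀ x, |sdeGenerator (P.langevinDrift N) (P.noiseVecL N T_L) (P.noiseVecR N T_R)
      (fun y => smoothCutoff (P.hamiltonian N y / R)) x| ≤ K) :
    (1 / 2) * ∫ x, smoothCutoff (P.hamiltonian N x / R) * (-(deriv smoothCutoff (ρ x / M) / M) *
        carreDuChamp (P.noiseVecL N T_L) (P.noiseVecR N T_R) ρ ρ x) ≤
      1 * (K + 2 * P.γ) * ∫ x, (if M < ρ x then ρ x else 0) := by
  have hF : ∀ u : ℝ, HasDerivAt (fun s => s - M * linCutoff (s / M)) (1 - smoothCutoff (u / M)) u :=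
    fun u => (hasDerivAt_id u).sub (hasDerivAt_scaled_linCutoff hM.ne' u)
  have hF' : ∀ u : ℝ, HasDerivAt (fun s => 1 - smoothCutoff (s / M)) (-(deriv smoothCutoff (u / M) / M)) u :=
    fun u => (hasDerivAt_scaled_smoothCutoff M u).const_sub 1
  have hF'' : Continuous fun u : ℝ => -(deriv smoothCutoff (u / M) / M) :=
    ((((contDiff_smoothCutoff (n := 1)).continuous_deriv le_rfl).comp (continuous_id.div_const M)).div_const M).neg
  have hθ : Integrable fun x => (if M < ρ x then ρ x else 0) := by
    have e : (fun x => (if M < ρ x then ρ x else 0)) = {x | M < ρ x}.indicator ρ := by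
      funext x; simp only [Set.indicator_apply, Set.mem_setOf_eq]
    rw [e]
    exact hρi.indicator (measurableSet_lt measurable_const hρ.continuous.measurable)
  exact P.half_integral_weightedFisher_le hU hV hN hP.γ_nonneg T_L T_R hρ hρ0 hpde hF hF' hF''
    (θ := fun s => if M < s then s else 0) (ℓ := 1)
    (fun s hs => (sub_heightCutoff_bounds hM hs).1) (fun s hs => (sub_heightCutoff_bounds hM hs).2.1)
    (fun s hs => (sub_heightCutoff_bounds hM hs).2.2.1) (fun s hs => (sub_heightCutoff_bounds hM hs).2.2.2)
    hθ (P.contDiff_energyCutoff hU hV N R) (hP.hasCompactSupport_energyCutoff N hR)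
    (fun x => (P.energyCutoff_mem_Icc R x).2) hK

omit hU hV hρ hpde in
/-- **The cutoff term**, pointwise: if `|L̂ χ(H/R)| ≤ K` and `L̂ χ(H/R) = 0` off `{R ≤ H ≤ 2R}`, then
`ρ |L̂ χ(H/R)| ≤ K · 1_{R ≤ H} ρ` (`ρ ≥ 0`). [folklore] -/
theorem mul_abs_revGenerator_cutoff_le (hρ0 : ∀ x, 0 ≤ ρ x) {R K : ℝ}
    (hK : ∀ x, |sdeGenerator (fun y => -P.langevinDrift N y) (P.noiseVecL N T_L) (P.noiseVecR N T_R)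
      (fun y => smoothCutoff (P.hamiltonian N y / R)) x| ≤ K ∧
      (¬ (R ≤ P.hamiltonian N x ∧ P.hamiltonian N x ≤ 2 * R) →
        sdeGenerator (fun y => -P.langevinDrift N y) (P.noiseVecL N T_L) (P.noiseVecR N T_R)
          (fun y => smoothCutoff (P.hamiltonian N y / R)) x = 0)) (x : PhaseSpace N) :
    ρ x * |sdeGenerator (fun y => -P.langevinDrift N y) (P.noiseVecL N T_L) (P.noiseVecR N T_R)
        (fun y => smoothCutoff (P.hamiltonian N y / R)) x| ≤
      K * {x | R ≤ P.hamiltonian N x}.indicator ρ x := by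
  by_cases h : R ≤ P.hamiltonian N x
  · rw [Set.indicator_of_mem (show x ∈ {x | R ≤ P.hamiltonian N x} from h), mul_comm]
    exact mul_le_mul_of_nonneg_right (hK x).1 (hρ0 x)
  · rw [(hK x).2 (fun hc => h hc.1), abs_zero, mul_zero,
      Set.indicator_of_notMem (show x ∉ {x | R ≤ P.hamiltonian N x} from h), mul_zero]

end SiteChain

/-- **AM–GM on the height shell**: for a curvature profile `F'' > 0` with
`1/F''(s) ≤ W (s + δ)` on `[0, 2M]` (`M > 0`), every `ε > 0`, `s ≥ 0` and `y`:
`χ(s/M) |y| ≤ ½ (ε W (s + δ) + F''(s) y²/ε)` (`χ(s/M) ≤ 1` vanishes for `s ≥ 2M`). [folklore] -/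
theorem smoothCutoff_div_mul_abs_le {F'' : ℝ → ℝ} {M W δ ε s : ℝ} (hM : 0 < M) (hpos : ∀ s, 0 < F'' s)
    (hinv : ∀ s, 0 ≤ s → s ≤ 2 * M → 1 / F'' s ≤ W * (s + δ)) (hε : 0 < ε) (hs : 0 ≤ s)
    (hWs : 0 ≤ W * (s + δ)) (y : ℝ) :
    smoothCutoff (s / M) * |y| ≤ (ε * (W * (s + δ)) + F'' s * y ^ 2 / ε) / 2 := by
  have hrhs0 : 0 ≤ (ε * (W * (s + δ)) + F'' s * y ^ 2 / ε) / 2 := by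
    have := hpos s
    positivity
  by_cases h2M : s < 2 * M
  · calc smoothCutoff (s / M) * |y| ≤ 1 * |y| :=
          mul_le_mul_of_nonneg_right (smoothCutoff_le_one _) (abs_nonneg y)
      _ ≤ _ := by rw [one_mul]; exact abs_le_amgm_of_inv_le (hpos s) (hinv s hs h2M.le) hε y
  · rw [smoothCutoff_div_eq_zero_of_two_mul_le hM (not_lt.1 h2M), zero_mul]
    exact hrhs0

end Literature.MathematicalPhysics.KineticTheory.HeatConduction
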